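import Literature.NumberTheory.EllipticCurves.HasseWeilGoodReduction
import Literature.NumberTheory.GaloisRepresentations.IntegralGaloisActionProofs
import HarnessLib

/-!
# Euler factors of the Tate module at the places of bad reduction (named facts) and the
assembly of `hasseWeilEulerFactor_geomPoints` by reduction type

Topic `EllipticCurves`, sibling of `HasseWeilAbelian` (trunk EllArithM, item C15) and of
`HasseWeilGoodReduction`.  The named fact `WeierstrassCurve.hasseWeilEulerFactor_geomPoints W ℓ`
of `HasseWeilAbelian` — *for an elliptic curve `E/K` over a number field, a prime `ℓ` and a finite
place `v ∤ ℓ`, the `ℓ`-adic Euler factor `det(1 - σ_v T ∣ (V_ℓ E)_{I_v})` is Mathlib's local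
polynomial `L_v(E, T)`* (`1 - a_vT + q_vT²`, `1 - T`, `1 + T`, `1` according to the reduction type
of a minimal model at `v`; Silverman, *AEC*, C.§16, PDF p. 390) — is the one remaining input of
Knapp's Theorem 11.67 (isogenous curves have the same `L`-function,
`Literature.NumberTheory.EllipticCurves.LFunction_eq_of_isIsogenous`, reduced to it in
`ComplexMultiplicationLFunctionIsogenyProofs`) and of potential modularity (lang.S28).  Its good
places are isolated in `HasseWeilGoodReduction` (`hasseWeilEulerFactor_of_hasGoodReduction`,
Silverman VII.4.1 + V.2.3.1).  This file isolates the **bad places**, following the trichotomy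
good / multiplicative / additive of the local minimal model on which Mathlib's
`WeierstrassCurve.localPolynomial` branches (`LocalReduction`:
`hasGoodReductionAt_or_hasMultiplicativeReductionAt_or_hasAdditiveReductionAt`), and **proves the
assembly**: the four cases imply `hasseWeilEulerFactor_geomPoints` for elliptic `W`.

The Galois side at a bad place `v ∤ ℓ` is the structure of the inertia coinvariants
`(V_ℓ E)_{I_𝔓}` (`Literature.NumberTheory.GaloisRepresentations.ContinuousRep.InertiaCoinvariants`, the space on which
`Literature.NumberTheory.EllipticCurves.hasseWeilEulerFactor` takes the reversed characteristic polynomial of an arithmetic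
Frobenius `σ ∈ D_𝔓`), vendored as three **named facts** (D-0014):

* `WeierstrassCurve.inertiaCoinvariants_rationalTate_of_hasSplitMultiplicativeReductionAt W ℓ`:
  at a place of **split multiplicative** reduction, `(V_ℓ E)_{I_𝔓}` is a line on which `D_𝔓` acts
  trivially.  Source: Silverman, *ATAEC*, Exercise 5.13(a),(b) (PDF p. 416): for `E/K_v` with
  split multiplicative reduction and `ℓ ≠ p` there is an exact sequence of `G_{K̄_v/K_v}`-modules
  `1 → T_ℓ(μ) → T_ℓ(E) → ℤ_ℓ → 0` with trivial action on `ℤ_ℓ`, and in a suitable basis the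
  inertia group acts through `{(1 b; 0 1) : ord_ℓ(b) ≥ ord_ℓ(v(j_E))}` — in particular
  non-trivially, so `⟨τx - x⟩ = V_ℓ(μ)` and `(V_ℓ E)_{I} = V_ℓ(E)/V_ℓ(μ) ≅ ℚ_ℓ` with trivial
  action.  Hence `det(1 - σ T ∣ (V_ℓ E)_{I}) = 1 - T` (*AEC* C.§16: `L_v(T) = 1 - T`).
* `WeierstrassCurve.inertiaCoinvariants_rationalTate_of_hasNonsplitMultiplicativeReductionAt W ℓ`:
  at a place of **non-split multiplicative** reduction, `(V_ℓ E)_{I_𝔓}` is a line on which every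
  arithmetic Frobenius acts as `-1`.  Source: Silverman, *ATAEC*, Thm. V.5.3 with Lemma V.5.2(c)
  and Exercises 5.11(b), 5.13(a) (PDF pp. 406–409, 416): `E ≅ E_q` over `L = K_v(√γ(E/K_v))`,
  which is the unramified quadratic extension exactly in the non-split case, and the twisting
  isomorphism `ψ` satisfies `ψ(P)^σ = χ(σ)ψ(P^σ)` for the quadratic character `χ` of `L/K_v`; so
  `V_ℓ(E) ≅ V_ℓ(E_q) ⊗ χ`, `χ` is trivial on inertia, `(V_ℓ E)_{I} ≅ ℚ_ℓ(χ)`, and an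
  arithmetic Frobenius (which generates `Gal(L/K_v)`) acts as `χ(Frob_v) = -1`.  Hence
  `det(1 - σ T ∣ (V_ℓ E)_{I}) = 1 + T` (*AEC* C.§16: `L_v(T) = 1 + T`).
* `WeierstrassCurve.inertiaCoinvariants_rationalTate_eq_zero_of_hasAdditiveReductionAt W ℓ`: at
  a place of **additive** reduction, `(V_ℓ E)_{I_𝔓} = 0`.  Source: Silverman, *ATAEC*,
  Thm. IV.10.2(a) (PDF p. 358): `ε(E/K_v) = 2 - dim V_ℓ(E)^{I} = 2`, i.e. `V_ℓ(E)^{I} = 0`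
  (the tree's `codimFixed_inertia_rationalTate_eq_two_of_hasAdditiveReductionAt`,
  `HasseWeilAbelianConductor`); the coinvariants vanish with the invariants because `V_ℓ(E)` is
  self-dual up to the twist `ℚ_ℓ(1)`, which is unramified at `v ∤ ℓ` (Weil pairing
  `T_ℓ(E) × T_ℓ(E) → T_ℓ(μ)`, bilinear, alternating, non-degenerate, Galois invariant: *AEC*
  Prop. III.8.3, PDF p. 91), so `dim (V_ℓ E)_{I} = dim ((V_ℓ E)^∨)^{I} = dim (V_ℓ E(-1))^{I} =
  dim (V_ℓ E)^{I} = 0`.  Hence `det(1 - σ T ∣ 0) = 1` (*AEC* C.§16: `L_v(T) = 1`).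

*On the rendering* (as in `HasseWeilAbelianConductor`, `HasseWeilAbelianInertiaInvariants`,
`NeronOggShafarevich`): the sources are over the local field `K_v`; here `K` is a number field,
`𝔓 ∈ v.primesAbove` a prime of `\bar ℤ_K = absIntegers (𝓞 K) K` above `v`, `D_𝔓, I_𝔓 ≤ Γ_K`
its decomposition and inertia groups (Mathlib `Ideal.decompositionSubgroup` = stabiliser,
`Ideal.inertia`), which are the images of `G_{K̄_v/K_v} ⊇ I(K̄_v/K_v)` under the embedding cut
out by `𝔓` (Neukirch, *ANT*, II (9.6); the tree's `exists_mem_inertia_apply_eq_holds`), and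
`V_ℓ(E(K̄)) = V_ℓ(E(K̄_v))` since torsion points are algebraic; an arithmetic Frobenius is
Mathlib's `IsArithFrobAt (𝓞 K) σ 𝔓` (`σx ≡ x^{N v} mod 𝔓`), the element used by
`Literature.NumberTheory.EllipticCurves.hasseWeilEulerFactor`.  "Split/non-split multiplicative, additive reduction at `v`" are the
predicates of `LocalReduction` on the chosen local minimal model `W.localMinimalModel v`
(Mathlib `HasSplitMultiplicativeReduction` etc.), literally the tests of `localPolynomial`.
`[W.IsElliptic]` is quantified in the bodies and continuity `h` of the Galois action on `V_ℓ E`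
is an explicit hypothesis (it is the theorem `continuous_rationalGaloisRepTate_holds`), exactly
as in the sibling facts.

## Contents

* (proved) `WeierstrassCurve.localPolynomialAt_of_hasSplitMultiplicativeReductionAt`,
  `…_of_hasMultiplicativeReductionAt_of_not_hasSplitMultiplicativeReductionAt`,
  `…_of_hasAdditiveReductionAt`: `L_v(E, T) = 1 - T`, `1 + T`, `1` (unfolding Mathlib's
  `localPolynomial`; Silverman *AEC* C.§16);
* (proved, generic) `Literature.NumberTheory.EllipticCurves.hasseWeilEulerFactor_eq_of_forall_charpoly`: the Euler factor of a
  discrete `Γ_K`-module is `P` as soon as every arithmetic Frobenius at every `𝔓 ∣ v` has reversed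
  characteristic polynomial `P` on the inertia coinvariants (the chosen pair of the definition
  exists over a number field); `LinearMap.charpoly_eq_X_sub_C_of_finrank_eq_one`,
  `Polynomial.reverse_X_sub_C'`, `LinearMap.charpoly_eq_one_of_finrank_eq_zero`: the linear algebra
  of lines and of the zero space;
* (named facts) the three structures of `(V_ℓ E)_{I_𝔓}` above;
* (proved) `WeierstrassCurve.hasseWeilEulerFactor_of_hasSplitMultiplicativeReductionAt`
  (`= 1 - T`), `…_of_hasNonsplitMultiplicativeReductionAt` (`= 1 + T`),
  `…_of_hasAdditiveReductionAt` (`= 1`) from the respective facts;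
* (proved) `WeierstrassCurve.hasseWeilEulerFactor_geomPoints_of_reductionTypes`: **the named fact
  `hasseWeilEulerFactor_geomPoints W ℓ` (for elliptic `W`) follows from
  `hasseWeilEulerFactor_of_hasGoodReduction W ℓ` and the three bad-place facts**, and the schema
  form `forall_hasseWeilEulerFactor_geomPoints_of_reductionTypes` consumed by
  `Literature.NumberTheory.EllipticCurves.LFunction_eq_of_isIsogenous_of_hasseWeilEulerFactor_geomPoints` (Knapp 11.67).

## References

* J. H. Silverman, *Advanced Topics in the Arithmetic of Elliptic Curves*, GTM 151 (1994):
  §IV.10 Definition and Thm. 10.2(a) (PDF p. 358), §V.5 Lemma 5.2, Thm. 5.3, Cor. 5.4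
  (PDF pp. 406–409), Exercises 5.11, 5.13 (PDF p. 416). [SilvermanATAEC1994]
* J. H. Silverman, *The Arithmetic of Elliptic Curves*, 2nd ed. (2009): Prop. III.8.3 (PDF p. 91),
  §C.16 (PDF p. 390). [SilvermanAEC2009]
* J.-P. Serre, J. Tate, *Good reduction of abelian varieties*, Ann. of Math. 88 (1968), §1–§3.
  [SerreTate1968]

## Design

`noncomputable section`, `open scoped Classical`, one universe `u` (`K : Type u`) as in
`HasseWeilAbelian`; deliberate dot-notation extensions of Mathlib's `WeierstrassCurve`,
`LinearMap`, `Polynomial` namespaces for the auxiliary lemmas; the three named facts follow the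
quantifier layout of `HasseWeilAbelianConductor` (`∀ [W.IsElliptic] (h) (v) (hℓ) (hv) {𝔓} (h𝔓)`).
No instances, no `sorry`; the only `def`s are the three named facts.
-/

noncomputable section

open scoped Classical NumberField Polynomial

open Field IsDedekindDomain Polynomial

universe u

/-! ## Linear algebra of lines and of the zero space -/

namespace LinearMap

variable {k : Type*} [Field k] {V : Type*} [AddCommGroup V] [Module k V] [FiniteDimensional k V]

/-- On a line, the scalar endomorphism `c` has characteristic polynomial `X - c`
(Mathlib `LinearMap.charpoly_sub_smul` with `charpoly 0 = X ^ finrank`). [folklore] -/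
theorem charpoly_eq_X_sub_C_of_finrank_eq_one (h1 : Module.finrank k V = 1) (c : k)
    {f : Module.End k V} (hf : f = c • LinearMap.id) : f.charpoly = X - C c := by
  have h0 : f = 0 - (-c) • (1 : Module.End k V) := by
    rw [hf, neg_smul, zero_sub, neg_neg]; rfl
  rw [h0, LinearMap.charpoly_sub_smul, LinearMap.charpoly_zero, h1, pow_one, X_comp, C_neg,
    sub_eq_add_neg]

omit [FiniteDimensional k V] in
/-- On the zero space every endomorphism has characteristic polynomial `1` (it is monic of
degree `finrank = 0`). [folklore] -/
theorem charpoly_eq_one_of_finrank_eq_zero [Module.Finite k V] (h0 : Module.finrank k V = 0)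
    (f : Module.End k V) : f.charpoly = 1 := by
  have hdeg : f.charpoly.natDegree = 0 := by rw [LinearMap.charpoly_natDegree, h0]
  exact Polynomial.eq_one_of_monic_natDegree_zero (LinearMap.charpoly_monic f) hdeg

end LinearMap

namespace Polynomial

/-- `reverse 1 = 1`. [folklore] -/
theorem reverse_one' {R : Type*} [Semiring R] : (1 : R[X]).reverse = 1 := by
  simpa using reverse_C (1 : R)

/-- `reverse X = 1` over a nontrivial ring. [folklore] -/
theorem reverse_X' {R : Type*} [Semiring R] [Nontrivial R] : (X : R[X]).reverse = 1 := by
  simpa [reverse_one'] using reverse_mul_X (1 : R[X])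

/-- `reverse (X - c) = 1 - cX` over a nontrivial ring. [folklore] -/
theorem reverse_X_sub_C' {R : Type*} [CommRing R] [Nontrivial R] (c : R) :
    (X - C c : R[X]).reverse = 1 - C c * X := by
  rw [sub_eq_add_neg, ← C_neg, reverse_add_C, reverse_X', natDegree_X, pow_one, C_neg, neg_mul,
    ← sub_eq_add_neg]

end Polynomial

namespace Literature.NumberTheory.EllipticCurves

/-! ## The Euler factor from the inertia coinvariants at the primes above `v` -/

section EulerFactor

variable {K : Type u} [Field K] [NumberField K] (M : Type u) [AddCommGroup M]
  [DistribMulAction (absoluteGaloisGroup K) M] (ℓ : ℕ) [Fact ℓ.Prime]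

/-- **The Euler factor from the coinvariants.**  Over a number field the pair `(𝔓, σ)`
(`𝔓 ∣ v`, `σ` an arithmetic Frobenius at `𝔓`) chosen in the definition of
`Literature.NumberTheory.EllipticCurves.hasseWeilEulerFactor` exists (`HeightOneSpectrum.primesAbove_nonempty`,
`exists_isArithFrobAt_of_mem_primesAbove_holds`); so if *every* such pair has reversed
characteristic polynomial `P` on the inertia coinvariants `(V_ℓ M)_{I_𝔓}`, the Euler factor at
`v` is `P`.  Serre, *Facteurs locaux des fonctions zêta* (1970), §2.3; Serre–Tate (1968), §1.
[folklore] -/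
theorem hasseWeilEulerFactor_eq_of_forall_charpoly
    (h : Continuous fun x : absoluteGaloisGroup K × RationalTateModule M ℓ ↦
      rationalTateRepresentation (absoluteGaloisGroup K) M ℓ x.1 x.2)
    [Module.Finite ℚ_[ℓ] (RationalTateModule M ℓ)] (v : HeightOneSpectrum (𝓞 K))
    (P : Polynomial ℚ_[ℓ])
    (hP : ∀ {𝔓 : Ideal (GaloisRepresentations.absIntegers (𝓞 K) K)} (_h𝔓 : 𝔓 ∈ v.primesAbove)
      (σ : 𝔓.decompositionSubgroup (absoluteGaloisGroup K)),
      IsArithFrobAt (𝓞 K) (σ : absoluteGaloisGroup K) 𝔓 →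
        ((rationalTateGaloisRepOf M ℓ h).toInertiaCoinvariants 𝔓 σ).charpoly.reverse = P) :
    hasseWeilEulerFactor M ℓ h v = P := by
  have hex : ∃ 𝔓σ : Ideal (GaloisRepresentations.absIntegers (𝓞 K) K) × absoluteGaloisGroup K,
      𝔓σ.1 ∈ v.primesAbove ∧ IsArithFrobAt (𝓞 K) 𝔓σ.2 𝔓σ.1 := by
    obtain ⟨𝔓, h𝔓⟩ := HeightOneSpectrum.primesAbove_nonempty v
    obtain ⟨σ, hσ⟩ := HeightOneSpectrum.exists_isArithFrobAt_of_mem_primesAbove_holds h𝔓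
    exact ⟨(𝔓, σ), h𝔓, hσ⟩
  rw [hasseWeilEulerFactor, dif_pos hex]
  exact hP hex.choose_spec.1 _ hex.choose_spec.2

/-- If the inertia coinvariants at every `𝔓 ∣ v` form a line on which every arithmetic Frobenius
acts as the scalar `c`, the Euler factor at `v` is `1 - cT`. [folklore] -/
theorem hasseWeilEulerFactor_eq_of_finrank_eq_one
    (h : Continuous fun x : absoluteGaloisGroup K × RationalTateModule M ℓ ↦
      rationalTateRepresentation (absoluteGaloisGroup K) M ℓ x.1 x.2)
    [Module.Finite ℚ_[ℓ] (RationalTateModule M ℓ)] (v : HeightOneSpectrum (𝓞 K)) (c : ℚ_[ℓ])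
    (hc : ∀ {𝔓 : Ideal (GaloisRepresentations.absIntegers (𝓞 K) K)} (_h𝔓 : 𝔓 ∈ v.primesAbove),
      Module.finrank ℚ_[ℓ] ((rationalTateGaloisRepOf M ℓ h).InertiaCoinvariants 𝔓) = 1 ∧
        ∀ σ : 𝔓.decompositionSubgroup (absoluteGaloisGroup K),
          IsArithFrobAt (𝓞 K) (σ : absoluteGaloisGroup K) 𝔓 →
            (rationalTateGaloisRepOf M ℓ h).toInertiaCoinvariants 𝔓 σ = c • LinearMap.id) :
    hasseWeilEulerFactor M ℓ h v = 1 - C c * X := by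
  refine hasseWeilEulerFactor_eq_of_forall_charpoly M ℓ h v _ fun h𝔓 σ hσ ↦ ?_
  rw [LinearMap.charpoly_eq_X_sub_C_of_finrank_eq_one (hc h𝔓).1 c ((hc h𝔓).2 σ hσ),
    Polynomial.reverse_X_sub_C']

/-- If the inertia coinvariants at every `𝔓 ∣ v` vanish, the Euler factor at `v` is `1`.
[folklore] -/
theorem hasseWeilEulerFactor_eq_one_of_finrank_eq_zero
    (h : Continuous fun x : absoluteGaloisGroup K × RationalTateModule M ℓ ↦
      rationalTateRepresentation (absoluteGaloisGroup K) M ℓ x.1 x.2)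
    [Module.Finite ℚ_[ℓ] (RationalTateModule M ℓ)] (v : HeightOneSpectrum (𝓞 K))
    (h0 : ∀ {𝔓 : Ideal (GaloisRepresentations.absIntegers (𝓞 K) K)} (_h𝔓 : 𝔓 ∈ v.primesAbove),
      Module.finrank ℚ_[ℓ] ((rationalTateGaloisRepOf M ℓ h).InertiaCoinvariants 𝔓) = 0) :
    hasseWeilEulerFactor M ℓ h v = 1 := by
  refine hasseWeilEulerFactor_eq_of_forall_charpoly M ℓ h v _ fun h𝔓 σ _ ↦ ?_
  rw [LinearMap.charpoly_eq_one_of_finrank_eq_zero (h0 h𝔓), Polynomial.reverse_one']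

end EulerFactor

end Literature.NumberTheory.EllipticCurves

namespace WeierstrassCurve

open Literature.NumberTheory.EllipticCurves Literature.NumberTheory.GaloisRepresentations

/-! ## Mathlib's local polynomial at the places of bad reduction -/

section LocalPolynomial

variable {K : Type u} [Field K] [NumberField K] {W : WeierstrassCurve K}
  {v : HeightOneSpectrum (𝓞 K)}

/-- **`L_v(E, T) = 1 - T` at a place of split multiplicative reduction** (Silverman, *AEC*,
§C.16, PDF p. 390; for Mathlib's `localPolynomial`, computed on the chosen local minimal model,
which is not good and is split multiplicative). [cite: SilvermanAEC2009, §C.16 (PDF p. 390)] -/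
theorem localPolynomialAt_of_hasSplitMultiplicativeReductionAt
    (hv : W.HasSplitMultiplicativeReductionAt v) : W.localPolynomialAt v = 1 - X := by
  have h' : ((W.baseChange (v.adicCompletion K)).minimal
      (v.adicCompletionIntegers K)).HasSplitMultiplicativeReduction
        (v.adicCompletionIntegers K) := hv
  show localPolynomial _ _ = _
  unfold localPolynomial
  rw [if_neg h'.toHasMultiplicativeReduction.not_hasGoodReduction, if_pos h']

/-- **`L_v(E, T) = 1 + T` at a place of non-split multiplicative reduction** (Silverman,
*AEC*, §C.16, PDF p. 390; "non-split" is "multiplicative and not split" for the local minimal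
model). [cite: SilvermanAEC2009, §C.16 (PDF p. 390)] -/
theorem localPolynomialAt_of_hasMultiplicativeReductionAt_of_not_hasSplitMultiplicativeReductionAt
    (hv : W.HasMultiplicativeReductionAt v) (hns : ¬ W.HasSplitMultiplicativeReductionAt v) :
    W.localPolynomialAt v = 1 + X := by
  have h' : ((W.baseChange (v.adicCompletion K)).minimal
      (v.adicCompletionIntegers K)).HasMultiplicativeReduction (v.adicCompletionIntegers K) := hv
  have hns' : ¬ ((W.baseChange (v.adicCompletion K)).minimal
      (v.adicCompletionIntegers K)).HasSplitMultiplicativeReduction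
        (v.adicCompletionIntegers K) := hns
  show localPolynomial _ _ = _
  unfold localPolynomial
  rw [if_neg h'.not_hasGoodReduction, if_neg hns', if_pos h']

/-- **`L_v(E, T) = 1` at a place of additive reduction** (Silverman, *AEC*, §C.16, PDF p. 390;
the tree's `localPolynomial_eq_one_of_hasAdditiveReductionAt` of `LocalEulerFactorModel` is the
same statement, restated here for `localPolynomialAt` to keep the imports of this file inside the
Galois-representation cluster). [cite: SilvermanAEC2009, §C.16 (PDF p. 390)] -/
theorem localPolynomialAt_of_hasAdditiveReductionAt (hv : W.HasAdditiveReductionAt v) :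
    W.localPolynomialAt v = 1 := by
  have h' : ((W.baseChange (v.adicCompletion K)).minimal
      (v.adicCompletionIntegers K)).HasAdditiveReduction (v.adicCompletionIntegers K) := hv
  show localPolynomial _ _ = _
  unfold localPolynomial
  rw [if_neg h'.not_hasGoodReduction, if_neg, if_neg h'.not_hasMultiplicativeReduction]
  exact fun hs ↦ h'.not_hasMultiplicativeReduction _ hs.toHasMultiplicativeReduction

end LocalPolynomial

/-! ## The inertia coinvariants of `V_ℓ E` at the places of bad reduction (named facts) -/

section Facts

variable {K : Type u} [Field K] [NumberField K] (W : WeierstrassCurve K) (ℓ : ℕ) [Fact ℓ.Prime]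

/-- **Split multiplicative reduction: `(V_ℓ E)_{I_𝔓}` is a line with trivial Galois action.**
For an elliptic curve `E/K` over a number field with split multiplicative reduction at the finite
place `v ∤ ℓ` (`W.HasSplitMultiplicativeReductionAt v`) and a prime `𝔓 ∣ v` of `\bar ℤ_K`, the
inertia coinvariants `(V_ℓ E)_{I_𝔓}` of the rational Tate module are `1`-dimensional over `ℚ_ℓ`
and the decomposition group `D_𝔓` acts trivially on them.  Printed source (over the local field
`K_v`; `D_𝔓 ≅ G_{K̄_v/K_v}`, see the module docstring): Silverman, *ATAEC*, Exercise 5.13 —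
*(a) for each prime `ℓ ≠ p` there is an exact sequence of `G_{K̄/K}`-modules
`1 → T_ℓ(μ) → T_ℓ(E) → ℤ_ℓ → 0`, where `G_{K̄/K}` acts trivially on `ℤ_ℓ`; (b) there is a basis
for `T_ℓ(E)` so that the image of the inertial group in `Aut(T_ℓ(E)) ≅ GL₂(ℤ_ℓ)` is
`{(1 b; 0 1) : ord_ℓ(b) ≥ ord_ℓ(v_K(j_E))}`* (via the Tate curve, Thm. V.5.3).  By (b) inertia
acts non-trivially and unipotently, so the span of the `τx - x` (`τ ∈ I`) is the line `V_ℓ(μ)`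
and `(V_ℓ E)_{I} = V_ℓ(E)/V_ℓ(μ) ≅ ℚ_ℓ`, with trivial action by (a).  (Consequence for the Euler
factor: `det(1 - σ T ∣ (V_ℓ E)_{I}) = 1 - T = L_v(E, T)`, *AEC* C.§16;
`hasseWeilEulerFactor_of_hasSplitMultiplicativeReductionAt`.)
[cite: SilvermanATAEC1994, Exercise 5.13(a),(b) (PDF p. 416), with Thm. V.5.3] -/
def inertiaCoinvariants_rationalTate_of_hasSplitMultiplicativeReductionAt : Prop :=
  ∀ [W.IsElliptic]
    (h : Continuous fun x : absoluteGaloisGroup K × RationalTateModule (geomPoints W) ℓ ↦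
      rationalTateRepresentation (absoluteGaloisGroup K) (geomPoints W) ℓ x.1 x.2)
    (v : HeightOneSpectrum (𝓞 K)) (_hℓ : (ℓ : 𝓞 K) ∉ v.asIdeal)
    (_hv : W.HasSplitMultiplicativeReductionAt v)
    {𝔓 : Ideal (absIntegers (𝓞 K) K)} (_h𝔓 : 𝔓 ∈ v.primesAbove),
    Module.finrank ℚ_[ℓ] ((rationalTateGaloisRepOf (geomPoints W) ℓ h).InertiaCoinvariants 𝔓) = 1 ∧
      ∀ σ : 𝔓.decompositionSubgroup (absoluteGaloisGroup K),
        (rationalTateGaloisRepOf (geomPoints W) ℓ h).toInertiaCoinvariants 𝔓 σ = LinearMap.id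

/-- **Non-split multiplicative reduction: `(V_ℓ E)_{I_𝔓}` is a line on which Frobenius acts as
`-1`.**  For an elliptic curve `E/K` over a number field with non-split multiplicative reduction
at the finite place `v ∤ ℓ` (`W.HasMultiplicativeReductionAt v` and not
`W.HasSplitMultiplicativeReductionAt v`) and a prime `𝔓 ∣ v` of `\bar ℤ_K`, the inertia
coinvariants `(V_ℓ E)_{I_𝔓}` are `1`-dimensional and every arithmetic Frobenius `σ` at `𝔓`
(Mathlib `IsArithFrobAt`) acts on them as `-1`.  Printed source (over `K_v`): Silverman,
*ATAEC*, Thm. V.5.3 (Tate: for `|j(E)| > 1` there is a unique Tate curve `E_q/K` with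
`E ≅ E_q` over `K̄`, and `E ≅_K E_q` iff `γ(E/K) = 1` iff `E` has split multiplicative reduction),
Lemma V.5.2(c) (over `L = K(√(γ/γ'))` the isomorphism `ψ : E → E'` satisfies
`ψ(P)^σ = χ(σ)ψ(P^σ)`, `χ` the quadratic character of `L/K`), Exercise 5.11(b) (*`E/K` has
non-split multiplicative reduction iff `L = K(√γ(E/K))` is unramified of degree `2`*) and
Exercise 5.13(a) for `E_q`.  So `V_ℓ(E) ≅ V_ℓ(E_q) ⊗ χ` as `G_{K̄/K}`-modules with `χ` unramified:
the inertia coinvariants are those of `E_q` twisted by `χ`, a line `ℚ_ℓ(χ)`, and an arithmetic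
Frobenius generates `Gal(L/K)`, so acts as `χ(Frob) = -1`.  (Consequence:
`det(1 - σ T ∣ (V_ℓ E)_{I}) = 1 + T = L_v(E, T)`, *AEC* C.§16;
`hasseWeilEulerFactor_of_hasNonsplitMultiplicativeReductionAt`.)
[cite: SilvermanATAEC1994, Thm. V.5.3, Lemma V.5.2(c), Exercises 5.11(b) and 5.13(a) (PDF pp. 406–409, 416)] -/
def inertiaCoinvariants_rationalTate_of_hasNonsplitMultiplicativeReductionAt : Prop :=
  ∀ [W.IsElliptic]
    (h : Continuous fun x : absoluteGaloisGroup K × RationalTateModule (geomPoints W) ℓ ↦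
      rationalTateRepresentation (absoluteGaloisGroup K) (geomPoints W) ℓ x.1 x.2)
    (v : HeightOneSpectrum (𝓞 K)) (_hℓ : (ℓ : 𝓞 K) ∉ v.asIdeal)
    (_hv : W.HasMultiplicativeReductionAt v) (_hns : ¬ W.HasSplitMultiplicativeReductionAt v)
    {𝔓 : Ideal (absIntegers (𝓞 K) K)} (_h𝔓 : 𝔓 ∈ v.primesAbove),
    Module.finrank ℚ_[ℓ] ((rationalTateGaloisRepOf (geomPoints W) ℓ h).InertiaCoinvariants 𝔓) = 1 ∧
      ∀ σ : 𝔓.decompositionSubgroup (absoluteGaloisGroup K),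
        IsArithFrobAt (𝓞 K) (σ : absoluteGaloisGroup K) 𝔓 →
          (rationalTateGaloisRepOf (geomPoints W) ℓ h).toInertiaCoinvariants 𝔓 σ = -LinearMap.id

/-- **Additive reduction: `(V_ℓ E)_{I_𝔓} = 0`.**  For an elliptic curve `E/K` over a number
field with additive reduction at the finite place `v ∤ ℓ` (`W.HasAdditiveReductionAt v`) and a
prime `𝔓 ∣ v` of `\bar ℤ_K`, the inertia coinvariants of the rational Tate module vanish
(`dim_{ℚ_ℓ} (V_ℓ E)_{I_𝔓} = 0`).  Printed source (over `K_v`): Silverman, *ATAEC*, §IV.10,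
Definition (`ε(E/K) = dim(V_ℓ(E)/V_ℓ(E)^{I(K̄/K)}) = 2 - dim V_ℓ(E)^{I(K̄/K)}`) and Thm. 10.2(a)
(*`ε(E/K) = 2` if `E` has additive reduction*), i.e. the inertia **invariants** vanish (the
tree's `codimFixed_inertia_rationalTate_eq_two_of_hasAdditiveReductionAt`); the **co**invariants
have the same dimension because `V_ℓ(E)` is self-dual up to the twist by `ℚ_ℓ(1)`, unramified at
`v ∤ ℓ`: the Weil pairing `e : T_ℓ(E) × T_ℓ(E) → T_ℓ(μ)` is bilinear, alternating, non-degenerate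
and Galois invariant (Silverman, *AEC*, Prop. III.8.3), so
`dim (V_ℓ E)_{I} = dim ((V_ℓ E)_{I})^∨ = dim ((V_ℓ E)^∨)^{I} = dim (V_ℓ E ⊗ ℚ_ℓ(-1))^{I} =
dim (V_ℓ E)^{I} = 0`.  (Consequence: `det(1 - σ T ∣ 0) = 1 = L_v(E, T)`, *AEC* C.§16;
`hasseWeilEulerFactor_of_hasAdditiveReductionAt`.)
[cite: SilvermanATAEC1994, §IV.10 Definition and Thm. 10.2(a) (PDF p. 358)]
[cite: SilvermanAEC2009, Prop. III.8.3 (PDF p. 91)] -/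
def inertiaCoinvariants_rationalTate_eq_zero_of_hasAdditiveReductionAt : Prop :=
  ∀ [W.IsElliptic]
    (h : Continuous fun x : absoluteGaloisGroup K × RationalTateModule (geomPoints W) ℓ ↦
      rationalTateRepresentation (absoluteGaloisGroup K) (geomPoints W) ℓ x.1 x.2)
    (v : HeightOneSpectrum (𝓞 K)) (_hℓ : (ℓ : 𝓞 K) ∉ v.asIdeal)
    (_hv : W.HasAdditiveReductionAt v)
    {𝔓 : Ideal (absIntegers (𝓞 K) K)} (_h𝔓 : 𝔓 ∈ v.primesAbove),
    Module.finrank ℚ_[ℓ] ((rationalTateGaloisRepOf (geomPoints W) ℓ h).InertiaCoinvariants 𝔓) = 0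

end Facts

/-! ## The Euler factors at the places of bad reduction, from the facts -/

section EulerFactors

variable {K : Type u} [Field K] [NumberField K] (W : WeierstrassCurve K) [W.IsElliptic]
  (ℓ : ℕ) [Fact ℓ.Prime]

/-- **`det(1 - σ T ∣ (V_ℓ E)_{I_v}) = 1 - T` at a place of split multiplicative reduction**
`v ∤ ℓ`, from `inertiaCoinvariants_rationalTate_of_hasSplitMultiplicativeReductionAt` (a line
with trivial Frobenius: `charpoly = X - 1`, reversed `1 - X`).  Silverman, *ATAEC*, Ex. 5.13 with
*AEC* C.§16. [cite: SilvermanATAEC1994, Exercise 5.13(a),(b) (PDF p. 416)] -/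
theorem hasseWeilEulerFactor_of_hasSplitMultiplicativeReductionAt
    (hS : W.inertiaCoinvariants_rationalTate_of_hasSplitMultiplicativeReductionAt ℓ)
    (h : Continuous fun x : absoluteGaloisGroup K × RationalTateModule (geomPoints W) ℓ ↦
      rationalTateRepresentation (absoluteGaloisGroup K) (geomPoints W) ℓ x.1 x.2)
    [Module.Finite ℚ_[ℓ] (W.rationalTateModule ℓ)] {v : HeightOneSpectrum (𝓞 K)}
    (hℓ : (ℓ : 𝓞 K) ∉ v.asIdeal) (hv : W.HasSplitMultiplicativeReductionAt v) :
    hasseWeilEulerFactor (geomPoints W) ℓ h v = 1 - X := by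
  have := hasseWeilEulerFactor_eq_of_finrank_eq_one (geomPoints W) ℓ h v 1 fun h𝔓 ↦
    ⟨(hS h v hℓ hv h𝔓).1, fun σ _ ↦ by rw [(hS h v hℓ hv h𝔓).2 σ, one_smul]⟩
  rwa [C_1, one_mul] at this

/-- **`det(1 - σ T ∣ (V_ℓ E)_{I_v}) = 1 + T` at a place of non-split multiplicative reduction**
`v ∤ ℓ`, from `inertiaCoinvariants_rationalTate_of_hasNonsplitMultiplicativeReductionAt` (a line
on which Frobenius is `-1`: `charpoly = X + 1`, reversed `1 + X`).  Silverman, *ATAEC*, V.5.3,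
V.5.2(c), Ex. 5.11(b), 5.13 with *AEC* C.§16.
[cite: SilvermanATAEC1994, Thm. V.5.3 and Exercises 5.11(b), 5.13 (PDF pp. 407, 416)] -/
theorem hasseWeilEulerFactor_of_hasNonsplitMultiplicativeReductionAt
    (hN : W.inertiaCoinvariants_rationalTate_of_hasNonsplitMultiplicativeReductionAt ℓ)
    (h : Continuous fun x : absoluteGaloisGroup K × RationalTateModule (geomPoints W) ℓ ↦
      rationalTateRepresentation (absoluteGaloisGroup K) (geomPoints W) ℓ x.1 x.2)
    [Module.Finite ℚ_[ℓ] (W.rationalTateModule ℓ)] {v : HeightOneSpectrum (𝓞 K)}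
    (hℓ : (ℓ : 𝓞 K) ∉ v.asIdeal) (hv : W.HasMultiplicativeReductionAt v)
    (hns : ¬ W.HasSplitMultiplicativeReductionAt v) :
    hasseWeilEulerFactor (geomPoints W) ℓ h v = 1 + X := by
  have := hasseWeilEulerFactor_eq_of_finrank_eq_one (geomPoints W) ℓ h v (-1) fun h𝔓 ↦
    ⟨(hN h v hℓ hv hns h𝔓).1, fun σ hσ ↦ by
      rw [(hN h v hℓ hv hns h𝔓).2 σ hσ, neg_smul, one_smul]⟩
  rwa [C_neg, C_1, neg_mul, one_mul, sub_neg_eq_add] at this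

/-- **`det(1 - σ T ∣ (V_ℓ E)_{I_v}) = 1` at a place of additive reduction** `v ∤ ℓ`, from
`inertiaCoinvariants_rationalTate_eq_zero_of_hasAdditiveReductionAt`.  Silverman, *ATAEC*,
IV.10.2(a) with *AEC* III.8.3, C.§16. [cite: SilvermanATAEC1994, Thm. IV.10.2(a) (PDF p. 358)] -/
theorem hasseWeilEulerFactor_of_hasAdditiveReductionAt
    (hA : W.inertiaCoinvariants_rationalTate_eq_zero_of_hasAdditiveReductionAt ℓ)
    (h : Continuous fun x : absoluteGaloisGroup K × RationalTateModule (geomPoints W) ℓ ↦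
      rationalTateRepresentation (absoluteGaloisGroup K) (geomPoints W) ℓ x.1 x.2)
    [Module.Finite ℚ_[ℓ] (W.rationalTateModule ℓ)] {v : HeightOneSpectrum (𝓞 K)}
    (hℓ : (ℓ : 𝓞 K) ∉ v.asIdeal) (hv : W.HasAdditiveReductionAt v) :
    hasseWeilEulerFactor (geomPoints W) ℓ h v = 1 :=
  hasseWeilEulerFactor_eq_one_of_finrank_eq_zero (geomPoints W) ℓ h v fun h𝔓 ↦ hA h v hℓ hv h𝔓

/-! ## Assembly: `hasseWeilEulerFactor_geomPoints` by reduction type -/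

/-- **The Euler-factor fact from its four cases.**  For an elliptic curve `E/K` over a number
field and a prime `ℓ`, the named fact `hasseWeilEulerFactor_geomPoints W ℓ` of `HasseWeilAbelian`
(`det(1 - σ_v T ∣ (V_ℓ E)_{I_v}) = L_v(E, T)` at every `v ∤ ℓ`) follows from its good-reduction
case `hasseWeilEulerFactor_of_hasGoodReduction W ℓ` (`HasseWeilGoodReduction`; Silverman
VII.4.1 + V.2.3.1) and the three bad-place structures of the inertia coinvariants vendored above
(Silverman *ATAEC* Ex. 5.13, Thm. V.5.3, Thm. IV.10.2(a)): the local minimal model at `v` has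
good, multiplicative (split or not) or additive reduction
(`hasGoodReductionAt_or_hasMultiplicativeReductionAt_or_hasAdditiveReductionAt`), and in the bad
cases both sides are `1 - T`, `1 + T`, `1` (Silverman, *AEC*, C.§16).
[cite: SilvermanAEC2009, §C.16 (PDF p. 390)] [cite: SerreTate1968, Thm. 3] -/
theorem hasseWeilEulerFactor_geomPoints_of_reductionTypes
    (hG : W.hasseWeilEulerFactor_of_hasGoodReduction ℓ)
    (hS : W.inertiaCoinvariants_rationalTate_of_hasSplitMultiplicativeReductionAt ℓ)
    (hN : W.inertiaCoinvariants_rationalTate_of_hasNonsplitMultiplicativeReductionAt ℓ)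
    (hA : W.inertiaCoinvariants_rationalTate_eq_zero_of_hasAdditiveReductionAt ℓ) :
    W.hasseWeilEulerFactor_geomPoints ℓ := by
  intro h hfin v hℓ
  haveI := hfin
  rcases hasGoodReductionAt_or_hasMultiplicativeReductionAt_or_hasAdditiveReductionAt v W with
    hg | hm | ha
  · exact hG h hfin v hℓ hg
  · by_cases hs : W.HasSplitMultiplicativeReductionAt v
    · rw [W.hasseWeilEulerFactor_of_hasSplitMultiplicativeReductionAt ℓ hS h hℓ hs,
        localPolynomialAt_of_hasSplitMultiplicativeReductionAt hs]
      simp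
    · rw [W.hasseWeilEulerFactor_of_hasNonsplitMultiplicativeReductionAt ℓ hN h hℓ hm hs,
        localPolynomialAt_of_hasMultiplicativeReductionAt_of_not_hasSplitMultiplicativeReductionAt
          hm hs]
      simp
  · rw [W.hasseWeilEulerFactor_of_hasAdditiveReductionAt ℓ hA h hℓ ha,
      localPolynomialAt_of_hasAdditiveReductionAt ha]
    simp

end EulerFactors

section Schema

variable {K : Type u} [Field K] [NumberField K]

/-- Schema form over a fixed number field `K`: if the good-reduction Euler factors and the three
bad-place structures hold for every elliptic curve over `K` and every prime `ℓ`, then so does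
`hasseWeilEulerFactor_geomPoints` — the hypothesis of
`Literature.NumberTheory.EllipticCurves.LFunction_eq_of_isIsogenous_of_hasseWeilEulerFactor_geomPoints` (Knapp, Thm. 11.67) for
`K = ℚ` and of the potential-modularity reductions (lang.S28). [folklore] -/
theorem forall_hasseWeilEulerFactor_geomPoints_of_reductionTypes
    (hG : ∀ (W : WeierstrassCurve K) [W.IsElliptic] (ℓ : ℕ) [Fact ℓ.Prime],
      W.hasseWeilEulerFactor_of_hasGoodReduction ℓ)
    (hS : ∀ (W : WeierstrassCurve K) [W.IsElliptic] (ℓ : ℕ) [Fact ℓ.Prime],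
      W.inertiaCoinvariants_rationalTate_of_hasSplitMultiplicativeReductionAt ℓ)
    (hN : ∀ (W : WeierstrassCurve K) [W.IsElliptic] (ℓ : ℕ) [Fact ℓ.Prime],
      W.inertiaCoinvariants_rationalTate_of_hasNonsplitMultiplicativeReductionAt ℓ)
    (hA : ∀ (W : WeierstrassCurve K) [W.IsElliptic] (ℓ : ℕ) [Fact ℓ.Prime],
      W.inertiaCoinvariants_rationalTate_eq_zero_of_hasAdditiveReductionAt ℓ) :
    ∀ (W : WeierstrassCurve K) [W.IsElliptic] (ℓ : ℕ) [Fact ℓ.Prime],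
      W.hasseWeilEulerFactor_geomPoints ℓ :=
  fun W _ ℓ _ ↦ W.hasseWeilEulerFactor_geomPoints_of_reductionTypes ℓ (hG W ℓ) (hS W ℓ) (hN W ℓ)
    (hA W ℓ)

end Schema

end WeierstrassCurve
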